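import Literature.Computability.MetaComplexity.EFModAddUYields
import HarnessLib

/-!
# The middle-four interchange of uniform modular addition: `(a ⊕ b) ⊕ (c ⊕ d) = (a ⊕ c) ⊕ (b ⊕ d)`

Layer D (uniform variant), part 5. The interchange law is the workhorse of the linearity laws of
modular multiplication (`2(u ⊕ v) = 2u ⊕ 2v` and `(u ⊕ m) ⊕ (v ⊕ m') = (u ⊕ v) ⊕ (m ⊕ m')`).
It is packaged like the associativity kit (`EFModAddUAssocKit.lean`): ONE template
`ModAddU.MFI.mfiT L` on the inputs `a, b, c, d, n` (a `Netlist.layout` of 16 pieces: the four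
operand comparators, the six modular adders `N₁ = a ⊕ b`, `N₂ = c ⊕ d`, `N₃ = N₁ ⊕ N₂`,
`N₄ = a ⊕ c`, `N₅ = b ⊕ d`, `N₆ = N₄ ⊕ N₅`, the comparators of `R(N₂)`, `R(N₅)`, and four
associativity kits), and ONE derivation `ModAddU.MFI.yields` (in the compositional form
`FregeSystem.Yields` of `EFDerives.lean`) of the bitwise equality `R(N₃) ≡ R(N₆)` from the
availability of an occurrence, the facts `a, b, c, d < n` about the kit's comparators and the
falsity of the high bits of `a, b, c, d, n`.

Proof: `(a⊕b)⊕(c⊕d) ≡ a⊕(b⊕(c⊕d))` (kit 1), `b⊕(c⊕d) ≡ (b⊕c)⊕d` (kit 2), `b⊕c ≡ c⊕b`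
(commutativity), `(c⊕b)⊕d ≡ c⊕(b⊕d)` (kit 3), `a⊕(c⊕(b⊕d)) ≡ (a⊕c)⊕(b⊕d)` (kit 4), glued by
congruence (`ModAddU.PairData.isBlock_leibLines`) and the bitwise-equality toolkit.

## Sources

* S. A. Cook, R. A. Reckhow, *The relative efficiency of propositional proof systems*,
  J. Symbolic Logic 44 (1979), §2.
* J. Krajíček, *Bounded Arithmetic, Propositional Logic, and Complexity Theory* (CUP 1995), §9.2.
-/

namespace Literature.Computability.MetaComplexity

open _root_.Computability Complexity Complexity.PropForm Netlist Cluster FregeSystem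

namespace ModAddU

namespace MFI

/-- The offset of piece `k` (closed form; a chain of literal tests). [folklore] -/
def off (L : ℕ) (k : ℕ) : ℕ :=
  if k = 0 then 0 else
  if k = 1 then 3 * L + 1 else
  if k = 2 then 6 * L + 2 else
  if k = 3 then 9 * L + 3 else
  if k = 4 then 12 * L + 4 else
  if k = 5 then 18 * L + 6 else
  if k = 6 then 24 * L + 8 else
  if k = 7 then 30 * L + 10 else
  if k = 8 then 36 * L + 12 else
  if k = 9 then 42 * L + 14 else
  if k = 10 then 48 * L + 16 else
  if k = 11 then 51 * L + 17 else
  if k = 12 then 54 * L + 18 else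
  if k = 13 then 109 * L + 35 else
  if k = 14 then 164 * L + 52 else
  if k = 15 then 219 * L + 69 else
  274 * L + 86

/-- The 16 pieces (inputs `a`=`0…L-1`, `b`=`L…`, `c`=`2L…`, `d`=`3L…`, `n`=`4L…5L-1`): comparators
`Ca,Cb,Cc,Cd`; `N₁=a⊕b`, `N₂=c⊕d`, `N₃=N₁⊕N₂`, `N₄=a⊕c`, `N₅=b⊕d`, `N₆=N₄⊕N₅`; comparators of
`R(N₂)`, `R(N₅)`; associativity kits `K1(a,b,R(N₂))`, `K2(b,c,d)`, `K3(c,b,d)`, `K4(a,c,R(N₅))`.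
[cite: Vollmer1999, §1.2] -/
def pieces (L : ℕ) (k : ℕ) : Piece :=
  if k = 0 then ⟨Sub.subT L, 2 * L, fun i => if i < L then Sum.inl i else Sum.inl (3 * L + i)⟩ else
  if k = 1 then ⟨Sub.subT L, 2 * L, fun i => if i < L then Sum.inl (L + i) else Sum.inl (3 * L + i)⟩ else
  if k = 2 then ⟨Sub.subT L, 2 * L, fun i => if i < L then Sum.inl (2 * L + i) else Sum.inl (3 * L + i)⟩ else
  if k = 3 then ⟨Sub.subT L, 2 * L, fun i => Sum.inl (3 * L + i)⟩ else
  if k = 4 then ⟨modAddT L, 3 * L, fun i => if i < 2 * L then Sum.inl i else Sum.inl (2 * L + i)⟩ else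
  if k = 5 then ⟨modAddT L, 3 * L, fun i => Sum.inl (2 * L + i)⟩ else
  if k = 6 then ⟨modAddT L, 3 * L, fun i => if i < L then Sum.inr (off L 4 + (5 * L + 2) + i) else
      if i < 2 * L then Sum.inr (off L 5 + (5 * L + 2) + (i - L)) else Sum.inl (2 * L + i)⟩ else
  if k = 7 then ⟨modAddT L, 3 * L, fun i => if i < L then Sum.inl i else if i < 2 * L then Sum.inl (L + i) else Sum.inl (2 * L + i)⟩ else
  if k = 8 then ⟨modAddT L, 3 * L, fun i => if i < L then Sum.inl (L + i) else Sum.inl (2 * L + i)⟩ else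
  if k = 9 then ⟨modAddT L, 3 * L, fun i => if i < L then Sum.inr (off L 7 + (5 * L + 2) + i) else
      if i < 2 * L then Sum.inr (off L 8 + (5 * L + 2) + (i - L)) else Sum.inl (2 * L + i)⟩ else
  if k = 10 then ⟨Sub.subT L, 2 * L, fun i => if i < L then Sum.inr (off L 5 + (5 * L + 2) + i) else Sum.inl (3 * L + i)⟩ else
  if k = 11 then ⟨Sub.subT L, 2 * L, fun i => if i < L then Sum.inr (off L 8 + (5 * L + 2) + i) else Sum.inl (3 * L + i)⟩ else
  if k = 12 then ⟨AssocKit.kitT L, 4 * L, fun i => if i < 2 * L then Sum.inl i else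
      if i < 3 * L then Sum.inr (off L 5 + (5 * L + 2) + (i - 2 * L)) else Sum.inl (L + i)⟩ else
  if k = 13 then ⟨AssocKit.kitT L, 4 * L, fun i => Sum.inl (L + i)⟩ else
  if k = 14 then ⟨AssocKit.kitT L, 4 * L, fun i => if i < L then Sum.inl (2 * L + i) else if i < 2 * L then Sum.inl i else Sum.inl (L + i)⟩ else
  if k = 15 then ⟨AssocKit.kitT L, 4 * L, fun i => if i < L then Sum.inl i else if i < 2 * L then Sum.inl (L + i) else
      if i < 3 * L then Sum.inr (off L 8 + (5 * L + 2) + (i - 2 * L)) else Sum.inl (L + i)⟩ else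
  ⟨[], 0, Sum.inl⟩

/-- The offsets, unfolded. [folklore] -/
theorem off_eq (L : ℕ) :
    off L 0 = 0 ∧
    off L 1 = 3 * L + 1 ∧
    off L 2 = 6 * L + 2 ∧
    off L 3 = 9 * L + 3 ∧
    off L 4 = 12 * L + 4 ∧
    off L 5 = 18 * L + 6 ∧
    off L 6 = 24 * L + 8 ∧
    off L 7 = 30 * L + 10 ∧
    off L 8 = 36 * L + 12 ∧
    off L 9 = 42 * L + 14 ∧
    off L 10 = 48 * L + 16 ∧
    off L 11 = 51 * L + 17 ∧
    off L 12 = 54 * L + 18 ∧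
    off L 13 = 109 * L + 35 ∧
    off L 14 = 164 * L + 52 ∧
    off L 15 = 219 * L + 69 ∧
    off L 16 = 274 * L + 86 :=
  ⟨rfl, rfl, rfl, rfl, rfl, rfl, rfl, rfl, rfl, rfl, rfl, rfl, rfl, rfl, rfl, rfl, rfl⟩

/-- Piece `0`, unfolded. [folklore] -/
theorem pieces_0 (L : ℕ) : pieces L 0 = ⟨Sub.subT L, 2 * L, fun i => if i < L then Sum.inl i else Sum.inl (3 * L + i)⟩ := rfl

/-- Piece `1`, unfolded. [folklore] -/
theorem pieces_1 (L : ℕ) : pieces L 1 = ⟨Sub.subT L, 2 * L, fun i => if i < L then Sum.inl (L + i) else Sum.inl (3 * L + i)⟩ := rfl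

/-- Piece `2`, unfolded. [folklore] -/
theorem pieces_2 (L : ℕ) : pieces L 2 = ⟨Sub.subT L, 2 * L, fun i => if i < L then Sum.inl (2 * L + i) else Sum.inl (3 * L + i)⟩ := rfl

/-- Piece `3`, unfolded. [folklore] -/
theorem pieces_3 (L : ℕ) : pieces L 3 = ⟨Sub.subT L, 2 * L, fun i => Sum.inl (3 * L + i)⟩ := rfl

/-- Piece `4`, unfolded. [folklore] -/
theorem pieces_4 (L : ℕ) : pieces L 4 = ⟨modAddT L, 3 * L, fun i => if i < 2 * L then Sum.inl i else Sum.inl (2 * L + i)⟩ := rfl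

/-- Piece `5`, unfolded. [folklore] -/
theorem pieces_5 (L : ℕ) : pieces L 5 = ⟨modAddT L, 3 * L, fun i => Sum.inl (2 * L + i)⟩ := rfl

/-- Piece `6`, unfolded. [folklore] -/
theorem pieces_6 (L : ℕ) : pieces L 6 = ⟨modAddT L, 3 * L, fun i => if i < L then Sum.inr (off L 4 + (5 * L + 2) + i) else
      if i < 2 * L then Sum.inr (off L 5 + (5 * L + 2) + (i - L)) else Sum.inl (2 * L + i)⟩ := rfl

/-- Piece `7`, unfolded. [folklore] -/
theorem pieces_7 (L : ℕ) : pieces L 7 = ⟨modAddT L, 3 * L, fun i => if i < L then Sum.inl i else if i < 2 * L then Sum.inl (L + i) else Sum.inl (2 * L + i)⟩ := rfl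

/-- Piece `8`, unfolded. [folklore] -/
theorem pieces_8 (L : ℕ) : pieces L 8 = ⟨modAddT L, 3 * L, fun i => if i < L then Sum.inl (L + i) else Sum.inl (2 * L + i)⟩ := rfl

/-- Piece `9`, unfolded. [folklore] -/
theorem pieces_9 (L : ℕ) : pieces L 9 = ⟨modAddT L, 3 * L, fun i => if i < L then Sum.inr (off L 7 + (5 * L + 2) + i) else
      if i < 2 * L then Sum.inr (off L 8 + (5 * L + 2) + (i - L)) else Sum.inl (2 * L + i)⟩ := rfl

/-- Piece `10`, unfolded. [folklore] -/
theorem pieces_10 (L : ℕ) : pieces L 10 = ⟨Sub.subT L, 2 * L, fun i => if i < L then Sum.inr (off L 5 + (5 * L + 2) + i) else Sum.inl (3 * L + i)⟩ := rfl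

/-- Piece `11`, unfolded. [folklore] -/
theorem pieces_11 (L : ℕ) : pieces L 11 = ⟨Sub.subT L, 2 * L, fun i => if i < L then Sum.inr (off L 8 + (5 * L + 2) + i) else Sum.inl (3 * L + i)⟩ := rfl

/-- Piece `12`, unfolded. [folklore] -/
theorem pieces_12 (L : ℕ) : pieces L 12 = ⟨AssocKit.kitT L, 4 * L, fun i => if i < 2 * L then Sum.inl i else
      if i < 3 * L then Sum.inr (off L 5 + (5 * L + 2) + (i - 2 * L)) else Sum.inl (L + i)⟩ := rfl

/-- Piece `13`, unfolded. [folklore] -/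
theorem pieces_13 (L : ℕ) : pieces L 13 = ⟨AssocKit.kitT L, 4 * L, fun i => Sum.inl (L + i)⟩ := rfl

/-- Piece `14`, unfolded. [folklore] -/
theorem pieces_14 (L : ℕ) : pieces L 14 = ⟨AssocKit.kitT L, 4 * L, fun i => if i < L then Sum.inl (2 * L + i) else if i < 2 * L then Sum.inl i else Sum.inl (L + i)⟩ := rfl

/-- Piece `15`, unfolded. [folklore] -/
theorem pieces_15 (L : ℕ) : pieces L 15 = ⟨AssocKit.kitT L, 4 * L, fun i => if i < L then Sum.inl i else if i < 2 * L then Sum.inl (L + i) else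
      if i < 3 * L then Sum.inr (off L 8 + (5 * L + 2) + (i - 2 * L)) else Sum.inl (L + i)⟩ := rfl

/-- **The middle-four-interchange kit**: the layout of the 16 pieces. [cite: Vollmer1999, §1.2] -/
def mfiT (L : ℕ) : Template := layout (pieces L) 16

/-- The offsets of the pieces are the closed forms. [folklore] -/
theorem offset_pieces (L : ℕ) : ∀ k ≤ 16, offset (pieces L) k = off L k := by
  have step : ∀ k < 16, offset (pieces L) k = off L k → offset (pieces L) (k + 1) = off L (k + 1) := by
    intro k hk h
    rw [offset_succ, h]
    obtain ⟨o0, o1, o2, o3, o4, o5, o6, o7, o8, o9, o10, o11, o12, o13, o14, o15, o16⟩ := off_eq L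
    interval_cases k <;> simp only [pieces_0, pieces_1, pieces_2, pieces_3, pieces_4, pieces_5, pieces_6, pieces_7, pieces_8, pieces_9, pieces_10, pieces_11, pieces_12, pieces_13, pieces_14, pieces_15, o0, o1, o2, o3, o4, o5, o6, o7, o8, o9, o10, o11, o12, o13, o14, o15, o16, Sub.length_subT, length_modAddT,
      AssocKit.length_kitT] <;> ring
  intro k hk
  induction k with
  | zero => rfl
  | succ k ih => exact step k (by omega) (ih (by omega))

/-- Length of the kit: `274L + 86` gates. [folklore] -/
@[simp] theorem length_mfiT (L : ℕ) : (mfiT L).length = 274 * L + 86 := by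
  rw [mfiT, length_layout, offset_pieces L 16 le_rfl]; rfl

/-- Every piece is well formed and well wired (`5L` inputs). [cite: Vollmer1999, Def. 1.6] -/
theorem piece_ok (L : ℕ) : ∀ k < 16, Piece.OK (pieces L) (5 * L) k := by
  intro k hk
  have hoff := offset_pieces L k (by omega)
  obtain ⟨o0, o1, o2, o3, o4, o5, o6, o7, o8, o9, o10, o11, o12, o13, o14, o15, o16⟩ := off_eq L
  unfold Piece.OK
  rw [hoff]
  interval_cases k <;> simp only [pieces_0, pieces_1, pieces_2, pieces_3, pieces_4, pieces_5, pieces_6, pieces_7, pieces_8, pieces_9, pieces_10, pieces_11, pieces_12, pieces_13, pieces_14, pieces_15]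

  · refine ⟨Sub.wf_subT L, fun i hi => ?_⟩
    split_ifs <;> exact ⟨fun a ha => (by cases ha; omega), fun g hg => by cases hg⟩

  · refine ⟨Sub.wf_subT L, fun i hi => ?_⟩
    split_ifs <;> exact ⟨fun a ha => (by cases ha; omega), fun g hg => by cases hg⟩

  · refine ⟨Sub.wf_subT L, fun i hi => ?_⟩
    split_ifs <;> exact ⟨fun a ha => (by cases ha; omega), fun g hg => by cases hg⟩

  · exact ⟨Sub.wf_subT L, fun i hi => ⟨fun a ha => (by cases ha; omega), fun g hg => by cases hg⟩⟩

  · refine ⟨wf_modAddT L, fun i hi => ?_⟩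
    split_ifs <;> exact ⟨fun a ha => (by cases ha; omega), fun g hg => by cases hg⟩

  · exact ⟨wf_modAddT L, fun i hi => ⟨fun a ha => (by cases ha; omega), fun g hg => by cases hg⟩⟩

  · refine ⟨wf_modAddT L, fun i hi => ?_⟩
    split_ifs <;> first
      | exact ⟨fun a ha => (by cases ha; omega), fun g hg => by cases hg⟩
      | exact ⟨fun a ha => (by cases ha), fun g hg => by cases hg; omega⟩

  · refine ⟨wf_modAddT L, fun i hi => ?_⟩
    split_ifs <;> exact ⟨fun a ha => (by cases ha; omega), fun g hg => by cases hg⟩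

  · refine ⟨wf_modAddT L, fun i hi => ?_⟩
    split_ifs <;> exact ⟨fun a ha => (by cases ha; omega), fun g hg => by cases hg⟩

  · refine ⟨wf_modAddT L, fun i hi => ?_⟩
    split_ifs <;> first
      | exact ⟨fun a ha => (by cases ha; omega), fun g hg => by cases hg⟩
      | exact ⟨fun a ha => (by cases ha), fun g hg => by cases hg; omega⟩

  · refine ⟨Sub.wf_subT L, fun i hi => ?_⟩
    split_ifs <;> first
      | exact ⟨fun a ha => (by cases ha; omega), fun g hg => by cases hg⟩
      | exact ⟨fun a ha => (by cases ha), fun g hg => by cases hg; omega⟩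

  · refine ⟨Sub.wf_subT L, fun i hi => ?_⟩
    split_ifs <;> first
      | exact ⟨fun a ha => (by cases ha; omega), fun g hg => by cases hg⟩
      | exact ⟨fun a ha => (by cases ha), fun g hg => by cases hg; omega⟩

  · refine ⟨AssocKit.wf_kitT L, fun i hi => ?_⟩
    split_ifs <;> first
      | exact ⟨fun a ha => (by cases ha; omega), fun g hg => by cases hg⟩
      | exact ⟨fun a ha => (by cases ha), fun g hg => by cases hg; omega⟩

  · exact ⟨AssocKit.wf_kitT L, fun i hi => ⟨fun a ha => (by cases ha; omega), fun g hg => by cases hg⟩⟩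

  · refine ⟨AssocKit.wf_kitT L, fun i hi => ?_⟩
    split_ifs <;> exact ⟨fun a ha => (by cases ha; omega), fun g hg => by cases hg⟩

  · refine ⟨AssocKit.wf_kitT L, fun i hi => ?_⟩
    split_ifs <;> first
      | exact ⟨fun a ha => (by cases ha; omega), fun g hg => by cases hg⟩
      | exact ⟨fun a ha => (by cases ha), fun g hg => by cases hg; omega⟩


/-- **The kit is well formed** (`5L` inputs). [cite: Vollmer1999, Def. 1.6] -/
theorem wf_mfiT (L : ℕ) : (mfiT L).WF (5 * L) := wf_layout (pieces L) (piece_ok L)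

/-! ### The views of an occurrence -/

section Views

variable (o : Occ) (L : ℕ)

/-- Operand `a`. [folklore] -/
def a (i : ℕ) : ℕ := o.inp i
/-- Operand `b`. [folklore] -/
def b (i : ℕ) : ℕ := o.inp (L + i)
/-- Operand `c`. [folklore] -/
def c (i : ℕ) : ℕ := o.inp (2 * L + i)
/-- Operand `d`. [folklore] -/
def d (i : ℕ) : ℕ := o.inp (3 * L + i)
/-- The modulus. [folklore] -/
def n (i : ℕ) : ℕ := o.inp (4 * L + i)
/-- Comparator of `a`. [folklore] -/
def Ca : Sub.View := ⟨o.base + off L 0, a o, n o L⟩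
/-- Comparator of `b`. [folklore] -/
def Cb : Sub.View := ⟨o.base + off L 1, b o L, n o L⟩
/-- Comparator of `c`. [folklore] -/
def Cc : Sub.View := ⟨o.base + off L 2, c o L, n o L⟩
/-- Comparator of `d`. [folklore] -/
def Cd : Sub.View := ⟨o.base + off L 3, d o L, n o L⟩
/-- `N₁ = a ⊕ b`. [folklore] -/
def N₁ : View := ⟨o.base + off L 4, a o, b o L, n o L⟩
/-- `N₂ = c ⊕ d`. [folklore] -/
def N₂ : View := ⟨o.base + off L 5, c o L, d o L, n o L⟩
/-- `N₃ = N₁ ⊕ N₂`. [folklore] -/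
def N₃ : View := ⟨o.base + off L 6, (N₁ o L).R L, (N₂ o L).R L, n o L⟩
/-- `N₄ = a ⊕ c`. [folklore] -/
def N₄ : View := ⟨o.base + off L 7, a o, c o L, n o L⟩
/-- `N₅ = b ⊕ d`. [folklore] -/
def N₅ : View := ⟨o.base + off L 8, b o L, d o L, n o L⟩
/-- `N₆ = N₄ ⊕ N₅`. [folklore] -/
def N₆ : View := ⟨o.base + off L 9, (N₄ o L).R L, (N₅ o L).R L, n o L⟩
/-- Comparator of `R(N₂)`. [folklore] -/
def CN2 : Sub.View := ⟨o.base + off L 10, (N₂ o L).R L, n o L⟩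
/-- Comparator of `R(N₅)`. [folklore] -/
def CN5 : Sub.View := ⟨o.base + off L 11, (N₅ o L).R L, n o L⟩
/-- The occurrence of kit `k` (`k = 12 … 15`). [folklore] -/
def K (k : ℕ) : Occ := pieceOcc (o.inst (5 * L)) (pieces L) k
/-- The data of kit `k`. [folklore] -/
def KD (k : ℕ) : AssocData := AssocKit.data (K o L k) L

/-- All pieces of the kit are available. [folklore] -/
structure MAvail (K' : PropForm ℕ) (Γ : Set (PropForm ℕ)) : Prop where
  /-- `Ca` -/
  hCa : (Ca o L).Avail K' Γ L
  /-- `Cb` -/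
  hCb : (Cb o L).Avail K' Γ L
  /-- `Cc` -/
  hCc : (Cc o L).Avail K' Γ L
  /-- `Cd` -/
  hCd : (Cd o L).Avail K' Γ L
  /-- `N₁` -/
  hN₁ : (N₁ o L).Avail K' Γ L
  /-- `N₂` -/
  hN₂ : (N₂ o L).Avail K' Γ L
  /-- `N₃` -/
  hN₃ : (N₃ o L).Avail K' Γ L
  /-- `N₄` -/
  hN₄ : (N₄ o L).Avail K' Γ L
  /-- `N₅` -/
  hN₅ : (N₅ o L).Avail K' Γ L
  /-- `N₆` -/
  hN₆ : (N₆ o L).Avail K' Γ L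
  /-- `CN2` -/
  hCN2 : (CN2 o L).Avail K' Γ L
  /-- `CN5` -/
  hCN5 : (CN5 o L).Avail K' Γ L
  /-- the kits -/
  hK : ∀ k, 12 ≤ k → k < 16 → (K o L k).Avail (AssocKit.kitT L) (4 * L) K' Γ

end Views

variable {L : ℕ} {o : Occ} {K' : PropForm ℕ} {Γ : Set (PropForm ℕ)}

/-- The base of the occurrence of piece `k`. [folklore] -/
theorem base_q {k : ℕ} (hk : k ≤ 16) : (pieceOcc (o.inst (5 * L)) (pieces L) k).base = o.base + off L k := by
  simp [pieceOcc, offset_pieces L k hk]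

/-- An input of a piece wired to a kit input. [folklore] -/
theorem inp_q_inl {k i j : ℕ} (hw : (pieces L k).wire i = Sum.inl j) (hj : j < 5 * L) :
    (pieceOcc (o.inst (5 * L)) (pieces L) k).inp i = o.inp j := by
  rw [inp_pieceOcc, hw, Occ.ref_inl o hj]

/-- An input of a piece wired to an earlier gate. [folklore] -/
theorem inp_q_inr {k i g : ℕ} (hw : (pieces L k).wire i = Sum.inr g) :
    (pieceOcc (o.inst (5 * L)) (pieces L) k).inp i = o.base + g := by
  rw [inp_pieceOcc, hw, Occ.ref_inr]; rfl

/-- Availability of `Ca`. [folklore] -/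
theorem avail_Ca (ho : o.Avail (mfiT L) (5 * L) K' Γ) : (Ca o L).Avail K' Γ L := by
  have hq : (pieceOcc (o.inst (5 * L)) (pieces L) 0).Avail (Sub.subT L) (2 * L) K' Γ := by
    have := Inst.DefsAvail.piece ho (k := 0) (by norm_num) (by rw [pieces_0]; exact Sub.wf_subT L)
    rw [pieces_0] at this; exact this
  refine Sub.View.Avail.congr (Sub.avail_viewOf hq) ?_ (fun i hi => ?_) (fun i hi => ?_)
  · show o.base + off L 0 = (pieceOcc (o.inst (5 * L)) (pieces L) 0).base
    rw [base_q (by norm_num)]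
  · show o.inp (i) = ((pieceOcc (o.inst (5 * L)) (pieces L) 0).inst (2 * L)).inputs.getD (i) 0
    rw [Occ.getD_inst _ (show i < 2 * L by omega),
      inp_q_inl (k := 0) (i := i) (j := i) (by simp only [pieces_0]; rw [if_pos (by omega)]) (by omega)]
  · show o.inp (4 * L + i) = ((pieceOcc (o.inst (5 * L)) (pieces L) 0).inst (2 * L)).inputs.getD (L + i) 0
    rw [Occ.getD_inst _ (show L + i < 2 * L by omega),
      inp_q_inl (k := 0) (i := L + i) (j := 4 * L + i) (by simp only [pieces_0]; rw [if_neg (by omega)]; congr 1; omega) (by omega)]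

/-- Availability of `Cb`. [folklore] -/
theorem avail_Cb (ho : o.Avail (mfiT L) (5 * L) K' Γ) : (Cb o L).Avail K' Γ L := by
  have hq : (pieceOcc (o.inst (5 * L)) (pieces L) 1).Avail (Sub.subT L) (2 * L) K' Γ := by
    have := Inst.DefsAvail.piece ho (k := 1) (by norm_num) (by rw [pieces_1]; exact Sub.wf_subT L)
    rw [pieces_1] at this; exact this
  refine Sub.View.Avail.congr (Sub.avail_viewOf hq) ?_ (fun i hi => ?_) (fun i hi => ?_)
  · show o.base + off L 1 = (pieceOcc (o.inst (5 * L)) (pieces L) 1).base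
    rw [base_q (by norm_num)]
  · show o.inp (L + i) = ((pieceOcc (o.inst (5 * L)) (pieces L) 1).inst (2 * L)).inputs.getD (i) 0
    rw [Occ.getD_inst _ (show i < 2 * L by omega),
      inp_q_inl (k := 1) (i := i) (j := L + i) (by simp only [pieces_1]; rw [if_pos (by omega)]) (by omega)]
  · show o.inp (4 * L + i) = ((pieceOcc (o.inst (5 * L)) (pieces L) 1).inst (2 * L)).inputs.getD (L + i) 0
    rw [Occ.getD_inst _ (show L + i < 2 * L by omega),
      inp_q_inl (k := 1) (i := L + i) (j := 4 * L + i) (by simp only [pieces_1]; rw [if_neg (by omega)]; congr 1; omega) (by omega)]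

/-- Availability of `Cc`. [folklore] -/
theorem avail_Cc (ho : o.Avail (mfiT L) (5 * L) K' Γ) : (Cc o L).Avail K' Γ L := by
  have hq : (pieceOcc (o.inst (5 * L)) (pieces L) 2).Avail (Sub.subT L) (2 * L) K' Γ := by
    have := Inst.DefsAvail.piece ho (k := 2) (by norm_num) (by rw [pieces_2]; exact Sub.wf_subT L)
    rw [pieces_2] at this; exact this
  refine Sub.View.Avail.congr (Sub.avail_viewOf hq) ?_ (fun i hi => ?_) (fun i hi => ?_)
  · show o.base + off L 2 = (pieceOcc (o.inst (5 * L)) (pieces L) 2).base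
    rw [base_q (by norm_num)]
  · show o.inp (2 * L + i) = ((pieceOcc (o.inst (5 * L)) (pieces L) 2).inst (2 * L)).inputs.getD (i) 0
    rw [Occ.getD_inst _ (show i < 2 * L by omega),
      inp_q_inl (k := 2) (i := i) (j := 2 * L + i) (by simp only [pieces_2]; rw [if_pos (by omega)]) (by omega)]
  · show o.inp (4 * L + i) = ((pieceOcc (o.inst (5 * L)) (pieces L) 2).inst (2 * L)).inputs.getD (L + i) 0
    rw [Occ.getD_inst _ (show L + i < 2 * L by omega),
      inp_q_inl (k := 2) (i := L + i) (j := 4 * L + i) (by simp only [pieces_2]; rw [if_neg (by omega)]; congr 1; omega) (by omega)]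

/-- Availability of `Cd`. [folklore] -/
theorem avail_Cd (ho : o.Avail (mfiT L) (5 * L) K' Γ) : (Cd o L).Avail K' Γ L := by
  have hq : (pieceOcc (o.inst (5 * L)) (pieces L) 3).Avail (Sub.subT L) (2 * L) K' Γ := by
    have := Inst.DefsAvail.piece ho (k := 3) (by norm_num) (by rw [pieces_3]; exact Sub.wf_subT L)
    rw [pieces_3] at this; exact this
  refine Sub.View.Avail.congr (Sub.avail_viewOf hq) ?_ (fun i hi => ?_) (fun i hi => ?_)
  · show o.base + off L 3 = (pieceOcc (o.inst (5 * L)) (pieces L) 3).base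
    rw [base_q (by norm_num)]
  · show o.inp (3 * L + i) = ((pieceOcc (o.inst (5 * L)) (pieces L) 3).inst (2 * L)).inputs.getD (i) 0
    rw [Occ.getD_inst _ (show i < 2 * L by omega),
      inp_q_inl (k := 3) (i := i) (j := 3 * L + i) (by rfl) (by omega)]
  · show o.inp (4 * L + i) = ((pieceOcc (o.inst (5 * L)) (pieces L) 3).inst (2 * L)).inputs.getD (L + i) 0
    rw [Occ.getD_inst _ (show L + i < 2 * L by omega),
      inp_q_inl (k := 3) (i := L + i) (j := 4 * L + i) (by simp only [pieces_3]; congr 1; omega) (by omega)]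

/-- Availability of `N₁ = a ⊕ b`. [folklore] -/
theorem avail_N₁ (ho : o.Avail (mfiT L) (5 * L) K' Γ) : (N₁ o L).Avail K' Γ L := by
  have hq : (pieceOcc (o.inst (5 * L)) (pieces L) 4).Avail (modAddT L) (3 * L) K' Γ := by
    have := Inst.DefsAvail.piece ho (k := 4) (by norm_num) (by rw [pieces_4]; exact wf_modAddT L)
    rw [pieces_4] at this; exact this
  refine View.Avail.congr (avail_viewOf hq) ?_ (fun i hi => ?_) (fun i hi => ?_) (fun i hi => ?_)
  · show o.base + off L 4 = (pieceOcc (o.inst (5 * L)) (pieces L) 4).base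
    rw [base_q (by norm_num)]
  · show o.inp i = ((pieceOcc (o.inst (5 * L)) (pieces L) 4).inst (3 * L)).inputs.getD (i) 0
    rw [Occ.getD_inst _ (show i < 3 * L by omega),
      inp_q_inl (k := 4) (i := i) (j := i) (by simp only [pieces_4]; rw [if_pos (by omega)]) (by omega)]
  · show o.inp (L + i) = ((pieceOcc (o.inst (5 * L)) (pieces L) 4).inst (3 * L)).inputs.getD (L + i) 0
    rw [Occ.getD_inst _ (show L + i < 3 * L by omega),
      inp_q_inl (k := 4) (i := L + i) (j := L + i) (by simp only [pieces_4]; rw [if_pos (by omega)]) (by omega)]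
  · show o.inp (4 * L + i) = ((pieceOcc (o.inst (5 * L)) (pieces L) 4).inst (3 * L)).inputs.getD (2 * L + i) 0
    rw [Occ.getD_inst _ (show 2 * L + i < 3 * L by omega),
      inp_q_inl (k := 4) (i := 2 * L + i) (j := 4 * L + i) (by simp only [pieces_4]; rw [if_neg (by omega)]; congr 1; omega) (by omega)]

/-- Availability of `N₂ = c ⊕ d`. [folklore] -/
theorem avail_N₂ (ho : o.Avail (mfiT L) (5 * L) K' Γ) : (N₂ o L).Avail K' Γ L := by
  have hq : (pieceOcc (o.inst (5 * L)) (pieces L) 5).Avail (modAddT L) (3 * L) K' Γ := by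
    have := Inst.DefsAvail.piece ho (k := 5) (by norm_num) (by rw [pieces_5]; exact wf_modAddT L)
    rw [pieces_5] at this; exact this
  refine View.Avail.congr (avail_viewOf hq) ?_ (fun i hi => ?_) (fun i hi => ?_) (fun i hi => ?_)
  · show o.base + off L 5 = (pieceOcc (o.inst (5 * L)) (pieces L) 5).base
    rw [base_q (by norm_num)]
  · show o.inp (2 * L + i) = ((pieceOcc (o.inst (5 * L)) (pieces L) 5).inst (3 * L)).inputs.getD (i) 0
    rw [Occ.getD_inst _ (show i < 3 * L by omega),
      inp_q_inl (k := 5) (i := i) (j := 2 * L + i) (by rfl) (by omega)]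
  · show o.inp (3 * L + i) = ((pieceOcc (o.inst (5 * L)) (pieces L) 5).inst (3 * L)).inputs.getD (L + i) 0
    rw [Occ.getD_inst _ (show L + i < 3 * L by omega),
      inp_q_inl (k := 5) (i := L + i) (j := 3 * L + i) (by simp only [pieces_5]; congr 1; omega) (by omega)]
  · show o.inp (4 * L + i) = ((pieceOcc (o.inst (5 * L)) (pieces L) 5).inst (3 * L)).inputs.getD (2 * L + i) 0
    rw [Occ.getD_inst _ (show 2 * L + i < 3 * L by omega),
      inp_q_inl (k := 5) (i := 2 * L + i) (j := 4 * L + i) (by simp only [pieces_5]; congr 1; omega) (by omega)]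

/-- Availability of `N₃ = N₁ ⊕ N₂`. [folklore] -/
theorem avail_N₃ (ho : o.Avail (mfiT L) (5 * L) K' Γ) : (N₃ o L).Avail K' Γ L := by
  have hq : (pieceOcc (o.inst (5 * L)) (pieces L) 6).Avail (modAddT L) (3 * L) K' Γ := by
    have := Inst.DefsAvail.piece ho (k := 6) (by norm_num) (by rw [pieces_6]; exact wf_modAddT L)
    rw [pieces_6] at this; exact this
  refine View.Avail.congr (avail_viewOf hq) ?_ (fun i hi => ?_) (fun i hi => ?_) (fun i hi => ?_)
  · show o.base + off L 6 = (pieceOcc (o.inst (5 * L)) (pieces L) 6).base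
    rw [base_q (by norm_num)]
  · show o.base + off L 4 + (5 * L + 2) + i = ((pieceOcc (o.inst (5 * L)) (pieces L) 6).inst (3 * L)).inputs.getD (i) 0
    rw [Occ.getD_inst _ (show i < 3 * L by omega),
      inp_q_inr (k := 6) (i := i) (g := off L 4 + (5 * L + 2) + i) (by simp only [pieces_6]; rw [if_pos (by omega)])]
    omega
  · show o.base + off L 5 + (5 * L + 2) + i = ((pieceOcc (o.inst (5 * L)) (pieces L) 6).inst (3 * L)).inputs.getD (L + i) 0
    rw [Occ.getD_inst _ (show L + i < 3 * L by omega),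
      inp_q_inr (k := 6) (i := L + i) (g := off L 5 + (5 * L + 2) + (L + i - L)) (by simp only [pieces_6]; rw [if_neg (by omega), if_pos (by omega)])]
    omega
  · show o.inp (4 * L + i) = ((pieceOcc (o.inst (5 * L)) (pieces L) 6).inst (3 * L)).inputs.getD (2 * L + i) 0
    rw [Occ.getD_inst _ (show 2 * L + i < 3 * L by omega),
      inp_q_inl (k := 6) (i := 2 * L + i) (j := 4 * L + i) (by simp only [pieces_6]; rw [if_neg (by omega), if_neg (by omega)]; congr 1; omega) (by omega)]

/-- Availability of `N₄ = a ⊕ c`. [folklore] -/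
theorem avail_N₄ (ho : o.Avail (mfiT L) (5 * L) K' Γ) : (N₄ o L).Avail K' Γ L := by
  have hq : (pieceOcc (o.inst (5 * L)) (pieces L) 7).Avail (modAddT L) (3 * L) K' Γ := by
    have := Inst.DefsAvail.piece ho (k := 7) (by norm_num) (by rw [pieces_7]; exact wf_modAddT L)
    rw [pieces_7] at this; exact this
  refine View.Avail.congr (avail_viewOf hq) ?_ (fun i hi => ?_) (fun i hi => ?_) (fun i hi => ?_)
  · show o.base + off L 7 = (pieceOcc (o.inst (5 * L)) (pieces L) 7).base
    rw [base_q (by norm_num)]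
  · show o.inp i = ((pieceOcc (o.inst (5 * L)) (pieces L) 7).inst (3 * L)).inputs.getD (i) 0
    rw [Occ.getD_inst _ (show i < 3 * L by omega),
      inp_q_inl (k := 7) (i := i) (j := i) (by simp only [pieces_7]; rw [if_pos (by omega)]) (by omega)]
  · show o.inp (2 * L + i) = ((pieceOcc (o.inst (5 * L)) (pieces L) 7).inst (3 * L)).inputs.getD (L + i) 0
    rw [Occ.getD_inst _ (show L + i < 3 * L by omega),
      inp_q_inl (k := 7) (i := L + i) (j := 2 * L + i) (by simp only [pieces_7]; rw [if_neg (by omega), if_pos (by omega)]; congr 1; omega) (by omega)]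
  · show o.inp (4 * L + i) = ((pieceOcc (o.inst (5 * L)) (pieces L) 7).inst (3 * L)).inputs.getD (2 * L + i) 0
    rw [Occ.getD_inst _ (show 2 * L + i < 3 * L by omega),
      inp_q_inl (k := 7) (i := 2 * L + i) (j := 4 * L + i) (by simp only [pieces_7]; rw [if_neg (by omega), if_neg (by omega)]; congr 1; omega) (by omega)]

/-- Availability of `N₅ = b ⊕ d`. [folklore] -/
theorem avail_N₅ (ho : o.Avail (mfiT L) (5 * L) K' Γ) : (N₅ o L).Avail K' Γ L := by
  have hq : (pieceOcc (o.inst (5 * L)) (pieces L) 8).Avail (modAddT L) (3 * L) K' Γ := by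
    have := Inst.DefsAvail.piece ho (k := 8) (by norm_num) (by rw [pieces_8]; exact wf_modAddT L)
    rw [pieces_8] at this; exact this
  refine View.Avail.congr (avail_viewOf hq) ?_ (fun i hi => ?_) (fun i hi => ?_) (fun i hi => ?_)
  · show o.base + off L 8 = (pieceOcc (o.inst (5 * L)) (pieces L) 8).base
    rw [base_q (by norm_num)]
  · show o.inp (L + i) = ((pieceOcc (o.inst (5 * L)) (pieces L) 8).inst (3 * L)).inputs.getD (i) 0
    rw [Occ.getD_inst _ (show i < 3 * L by omega),
      inp_q_inl (k := 8) (i := i) (j := L + i) (by simp only [pieces_8]; rw [if_pos (by omega)]) (by omega)]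
  · show o.inp (3 * L + i) = ((pieceOcc (o.inst (5 * L)) (pieces L) 8).inst (3 * L)).inputs.getD (L + i) 0
    rw [Occ.getD_inst _ (show L + i < 3 * L by omega),
      inp_q_inl (k := 8) (i := L + i) (j := 3 * L + i) (by simp only [pieces_8]; rw [if_neg (by omega)]; congr 1; omega) (by omega)]
  · show o.inp (4 * L + i) = ((pieceOcc (o.inst (5 * L)) (pieces L) 8).inst (3 * L)).inputs.getD (2 * L + i) 0
    rw [Occ.getD_inst _ (show 2 * L + i < 3 * L by omega),
      inp_q_inl (k := 8) (i := 2 * L + i) (j := 4 * L + i) (by simp only [pieces_8]; rw [if_neg (by omega)]; congr 1; omega) (by omega)]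

/-- Availability of `N₆ = N₄ ⊕ N₅`. [folklore] -/
theorem avail_N₆ (ho : o.Avail (mfiT L) (5 * L) K' Γ) : (N₆ o L).Avail K' Γ L := by
  have hq : (pieceOcc (o.inst (5 * L)) (pieces L) 9).Avail (modAddT L) (3 * L) K' Γ := by
    have := Inst.DefsAvail.piece ho (k := 9) (by norm_num) (by rw [pieces_9]; exact wf_modAddT L)
    rw [pieces_9] at this; exact this
  refine View.Avail.congr (avail_viewOf hq) ?_ (fun i hi => ?_) (fun i hi => ?_) (fun i hi => ?_)
  · show o.base + off L 9 = (pieceOcc (o.inst (5 * L)) (pieces L) 9).base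
    rw [base_q (by norm_num)]
  · show o.base + off L 7 + (5 * L + 2) + i = ((pieceOcc (o.inst (5 * L)) (pieces L) 9).inst (3 * L)).inputs.getD (i) 0
    rw [Occ.getD_inst _ (show i < 3 * L by omega),
      inp_q_inr (k := 9) (i := i) (g := off L 7 + (5 * L + 2) + i) (by simp only [pieces_9]; rw [if_pos (by omega)])]
    omega
  · show o.base + off L 8 + (5 * L + 2) + i = ((pieceOcc (o.inst (5 * L)) (pieces L) 9).inst (3 * L)).inputs.getD (L + i) 0
    rw [Occ.getD_inst _ (show L + i < 3 * L by omega),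
      inp_q_inr (k := 9) (i := L + i) (g := off L 8 + (5 * L + 2) + (L + i - L)) (by simp only [pieces_9]; rw [if_neg (by omega), if_pos (by omega)])]
    omega
  · show o.inp (4 * L + i) = ((pieceOcc (o.inst (5 * L)) (pieces L) 9).inst (3 * L)).inputs.getD (2 * L + i) 0
    rw [Occ.getD_inst _ (show 2 * L + i < 3 * L by omega),
      inp_q_inl (k := 9) (i := 2 * L + i) (j := 4 * L + i) (by simp only [pieces_9]; rw [if_neg (by omega), if_neg (by omega)]; congr 1; omega) (by omega)]

/-- Availability of the comparator of `R(N₂)`. [folklore] -/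
theorem avail_CN2 (ho : o.Avail (mfiT L) (5 * L) K' Γ) : (CN2 o L).Avail K' Γ L := by
  have hq : (pieceOcc (o.inst (5 * L)) (pieces L) 10).Avail (Sub.subT L) (2 * L) K' Γ := by
    have := Inst.DefsAvail.piece ho (k := 10) (by norm_num) (by rw [pieces_10]; exact Sub.wf_subT L)
    rw [pieces_10] at this; exact this
  refine Sub.View.Avail.congr (Sub.avail_viewOf hq) ?_ (fun i hi => ?_) (fun i hi => ?_)
  · show o.base + off L 10 = (pieceOcc (o.inst (5 * L)) (pieces L) 10).base
    rw [base_q (by norm_num)]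
  · show o.base + off L 5 + (5 * L + 2) + i = ((pieceOcc (o.inst (5 * L)) (pieces L) 10).inst (2 * L)).inputs.getD (i) 0
    rw [Occ.getD_inst _ (show i < 2 * L by omega),
      inp_q_inr (k := 10) (i := i) (g := off L 5 + (5 * L + 2) + i) (by simp only [pieces_10]; rw [if_pos (by omega)])]
    omega
  · show o.inp (4 * L + i) = ((pieceOcc (o.inst (5 * L)) (pieces L) 10).inst (2 * L)).inputs.getD (L + i) 0
    rw [Occ.getD_inst _ (show L + i < 2 * L by omega),
      inp_q_inl (k := 10) (i := L + i) (j := 4 * L + i) (by simp only [pieces_10]; rw [if_neg (by omega)]; congr 1; omega) (by omega)]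

/-- Availability of the comparator of `R(N₅)`. [folklore] -/
theorem avail_CN5 (ho : o.Avail (mfiT L) (5 * L) K' Γ) : (CN5 o L).Avail K' Γ L := by
  have hq : (pieceOcc (o.inst (5 * L)) (pieces L) 11).Avail (Sub.subT L) (2 * L) K' Γ := by
    have := Inst.DefsAvail.piece ho (k := 11) (by norm_num) (by rw [pieces_11]; exact Sub.wf_subT L)
    rw [pieces_11] at this; exact this
  refine Sub.View.Avail.congr (Sub.avail_viewOf hq) ?_ (fun i hi => ?_) (fun i hi => ?_)
  · show o.base + off L 11 = (pieceOcc (o.inst (5 * L)) (pieces L) 11).base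
    rw [base_q (by norm_num)]
  · show o.base + off L 8 + (5 * L + 2) + i = ((pieceOcc (o.inst (5 * L)) (pieces L) 11).inst (2 * L)).inputs.getD (i) 0
    rw [Occ.getD_inst _ (show i < 2 * L by omega),
      inp_q_inr (k := 11) (i := i) (g := off L 8 + (5 * L + 2) + i) (by simp only [pieces_11]; rw [if_pos (by omega)])]
    omega
  · show o.inp (4 * L + i) = ((pieceOcc (o.inst (5 * L)) (pieces L) 11).inst (2 * L)).inputs.getD (L + i) 0
    rw [Occ.getD_inst _ (show L + i < 2 * L by omega),
      inp_q_inl (k := 11) (i := L + i) (j := 4 * L + i) (by simp only [pieces_11]; rw [if_neg (by omega)]; congr 1; omega) (by omega)]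

/-- Availability of the kits. [folklore] -/
theorem avail_K (ho : o.Avail (mfiT L) (5 * L) K' Γ) : ∀ k, 12 ≤ k → k < 16 → (K o L k).Avail (AssocKit.kitT L) (4 * L) K' Γ := by
  intro k hk hk'
  have h4 : k = 12 ∨ k = 13 ∨ k = 14 ∨ k = 15 := by omega
  rcases h4 with rfl | rfl | rfl | rfl
  · have := Inst.DefsAvail.piece ho (k := 12) (by norm_num) (by rw [pieces_12]; exact AssocKit.wf_kitT L)
    rw [pieces_12] at this; exact this
  · have := Inst.DefsAvail.piece ho (k := 13) (by norm_num) (by rw [pieces_13]; exact AssocKit.wf_kitT L)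
    rw [pieces_13] at this; exact this
  · have := Inst.DefsAvail.piece ho (k := 14) (by norm_num) (by rw [pieces_14]; exact AssocKit.wf_kitT L)
    rw [pieces_14] at this; exact this
  · have := Inst.DefsAvail.piece ho (k := 15) (by norm_num) (by rw [pieces_15]; exact AssocKit.wf_kitT L)
    rw [pieces_15] at this; exact this

/-- **All pieces of an available occurrence of the kit are available.** [folklore] -/
theorem avail_ofOcc (ho : o.Avail (mfiT L) (5 * L) K' Γ) : MAvail o L K' Γ :=
  ⟨avail_Ca ho, avail_Cb ho, avail_Cc ho, avail_Cd ho, avail_N₁ ho, avail_N₂ ho, avail_N₃ ho, avail_N₄ ho, avail_N₅ ho,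
    avail_N₆ ho, avail_CN2 ho, avail_CN5 ho, avail_K ho⟩

/-- Availability of the pieces is monotone. [folklore] -/
theorem MAvail.mono {Γ' : Set (PropForm ℕ)} (h : MAvail o L K' Γ) (hΓ : Γ ⊆ Γ') : MAvail o L K' Γ' :=
  ⟨h.hCa.mono hΓ, h.hCb.mono hΓ, h.hCc.mono hΓ, h.hCd.mono hΓ, h.hN₁.mono hΓ, h.hN₂.mono hΓ, h.hN₃.mono hΓ, h.hN₄.mono hΓ,
    h.hN₅.mono hΓ, h.hN₆.mono hΓ, h.hCN2.mono hΓ, h.hCN5.mono hΓ, fun k h₁ h₂ => (h.hK k h₁ h₂).mono hΓ⟩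

/-! ### The inputs of the kits -/

/-- Input of kit `12`. [folklore] -/
theorem K1_a {i : ℕ} (hi : i < L) : (K o L 12).inp (i) = o.inp (i) :=
  inp_q_inl (k := 12) (i := i) (j := i) (by simp only [pieces_12]; rw [if_pos (by omega)]) (by omega)

/-- Input of kit `12`. [folklore] -/
theorem K1_b {i : ℕ} (hi : i < L) : (K o L 12).inp (L + i) = o.inp (L + i) :=
  inp_q_inl (k := 12) (i := L + i) (j := L + i) (by simp only [pieces_12]; rw [if_pos (by omega)]) (by omega)

/-- Input of kit `12` (an earlier gate). [folklore] -/
theorem K1_c {i : ℕ} (hi : i < L) : (K o L 12).inp (2 * L + i) = (N₂ o L).R L i := by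
  rw [show K o L 12 = pieceOcc (o.inst (5 * L)) (pieces L) 12 from rfl, inp_q_inr (k := 12) (i := 2 * L + i) (g := off L 5 + (5 * L + 2) + (2 * L + i - 2 * L)) (by simp only [pieces_12]; rw [if_neg (by omega), if_pos (by omega)])]
  show _ = o.base + off L 5 + (5 * L + 2) + i
  omega

/-- Input of kit `12`. [folklore] -/
theorem K1_n {i : ℕ} (hi : i < L) : (K o L 12).inp (3 * L + i) = o.inp (4 * L + i) :=
  inp_q_inl (k := 12) (i := 3 * L + i) (j := 4 * L + i) (by simp only [pieces_12]; rw [if_neg (by omega), if_neg (by omega)]; congr 1; omega) (by omega)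

/-- Input of kit `13`. [folklore] -/
theorem K2_a {i : ℕ} (hi : i < L) : (K o L 13).inp (i) = o.inp (L + i) :=
  inp_q_inl (k := 13) (i := i) (j := L + i) (by rfl) (by omega)

/-- Input of kit `13`. [folklore] -/
theorem K2_b {i : ℕ} (hi : i < L) : (K o L 13).inp (L + i) = o.inp (2 * L + i) :=
  inp_q_inl (k := 13) (i := L + i) (j := 2 * L + i) (by simp only [pieces_13]; congr 1; omega) (by omega)

/-- Input of kit `13`. [folklore] -/
theorem K2_c {i : ℕ} (hi : i < L) : (K o L 13).inp (2 * L + i) = o.inp (3 * L + i) :=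
  inp_q_inl (k := 13) (i := 2 * L + i) (j := 3 * L + i) (by simp only [pieces_13]; congr 1; omega) (by omega)

/-- Input of kit `13`. [folklore] -/
theorem K2_n {i : ℕ} (hi : i < L) : (K o L 13).inp (3 * L + i) = o.inp (4 * L + i) :=
  inp_q_inl (k := 13) (i := 3 * L + i) (j := 4 * L + i) (by simp only [pieces_13]; congr 1; omega) (by omega)

/-- Input of kit `14`. [folklore] -/
theorem K3_a {i : ℕ} (hi : i < L) : (K o L 14).inp (i) = o.inp (2 * L + i) :=
  inp_q_inl (k := 14) (i := i) (j := 2 * L + i) (by simp only [pieces_14]; rw [if_pos (by omega)]) (by omega)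

/-- Input of kit `14`. [folklore] -/
theorem K3_b {i : ℕ} (hi : i < L) : (K o L 14).inp (L + i) = o.inp (L + i) :=
  inp_q_inl (k := 14) (i := L + i) (j := L + i) (by simp only [pieces_14]; rw [if_neg (by omega), if_pos (by omega)]) (by omega)

/-- Input of kit `14`. [folklore] -/
theorem K3_c {i : ℕ} (hi : i < L) : (K o L 14).inp (2 * L + i) = o.inp (3 * L + i) :=
  inp_q_inl (k := 14) (i := 2 * L + i) (j := 3 * L + i) (by simp only [pieces_14]; rw [if_neg (by omega), if_neg (by omega)]; congr 1; omega) (by omega)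

/-- Input of kit `14`. [folklore] -/
theorem K3_n {i : ℕ} (hi : i < L) : (K o L 14).inp (3 * L + i) = o.inp (4 * L + i) :=
  inp_q_inl (k := 14) (i := 3 * L + i) (j := 4 * L + i) (by simp only [pieces_14]; rw [if_neg (by omega), if_neg (by omega)]; congr 1; omega) (by omega)

/-- Input of kit `15`. [folklore] -/
theorem K4_a {i : ℕ} (hi : i < L) : (K o L 15).inp (i) = o.inp (i) :=
  inp_q_inl (k := 15) (i := i) (j := i) (by simp only [pieces_15]; rw [if_pos (by omega)]) (by omega)

/-- Input of kit `15`. [folklore] -/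
theorem K4_b {i : ℕ} (hi : i < L) : (K o L 15).inp (L + i) = o.inp (2 * L + i) :=
  inp_q_inl (k := 15) (i := L + i) (j := 2 * L + i) (by simp only [pieces_15]; rw [if_neg (by omega), if_pos (by omega)]; congr 1; omega) (by omega)

/-- Input of kit `15` (an earlier gate). [folklore] -/
theorem K4_c {i : ℕ} (hi : i < L) : (K o L 15).inp (2 * L + i) = (N₅ o L).R L i := by
  rw [show K o L 15 = pieceOcc (o.inst (5 * L)) (pieces L) 15 from rfl, inp_q_inr (k := 15) (i := 2 * L + i) (g := off L 8 + (5 * L + 2) + (2 * L + i - 2 * L)) (by simp only [pieces_15]; rw [if_neg (by omega), if_neg (by omega), if_pos (by omega)])]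
  show _ = o.base + off L 8 + (5 * L + 2) + i
  omega

/-- Input of kit `15`. [folklore] -/
theorem K4_n {i : ℕ} (hi : i < L) : (K o L 15).inp (3 * L + i) = o.inp (4 * L + i) :=
  inp_q_inl (k := 15) (i := 3 * L + i) (j := 4 * L + i) (by simp only [pieces_15]; rw [if_neg (by omega), if_neg (by omega), if_neg (by omega)]; congr 1; omega) (by omega)


/-! ### Symmetry and transitivity lines -/

/-- The lines `vᵢ ↔ uᵢ`. [folklore] -/
def symmLines (K' : PropForm ℕ) (u v : ℕ → ℕ) (L : ℕ) : List (PropForm ℕ) :=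
  (List.range L).map fun i => ctx K' (eqv (v i) (u i))

/-- Symmetry, as a block. [cite: CookReckhow1979, §2] -/
theorem isBlock_symmLines {G : FregeSystem} (hGL : ∀ r ∈ Logic.rules, r ∈ G.rules) (K' : PropForm ℕ) {u v : ℕ → ℕ}
    {L : ℕ} {T : Set (PropForm ℕ)} (h : ∀ i < L, ctx K' (eqv (u i) (v i)) ∈ T) : G.IsBlock T (symmLines K' u v L) :=
  Scaffold.isBlock_of_forall fun θ hθ => by
    obtain ⟨i, hi, rfl⟩ := List.mem_map.1 hθ
    rw [List.mem_range] at hi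
    exact Or.inr (Logic.infer hGL 5 (by decide) (FregeSystem.sub [K', var (u i), var (v i)]) rfl
      (FregeSystem.prems_cons (h i hi) FregeSystem.prems_nil))

/-- The lines `uᵢ ↔ wᵢ` from `uᵢ ↔ vᵢ` and `vᵢ ↔ wᵢ`. [folklore] -/
def transLines (K' : PropForm ℕ) (u w : ℕ → ℕ) (L : ℕ) : List (PropForm ℕ) :=
  (List.range L).map fun i => ctx K' (eqv (u i) (w i))

/-- Transitivity, as a block. [cite: CookReckhow1979, §2] -/
theorem isBlock_transLines {G : FregeSystem} (hGL : ∀ r ∈ Logic.rules, r ∈ G.rules) (K' : PropForm ℕ)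
    {u v w : ℕ → ℕ} {L : ℕ} {T : Set (PropForm ℕ)} (h₁ : ∀ i < L, ctx K' (eqv (u i) (v i)) ∈ T)
    (h₂ : ∀ i < L, ctx K' (eqv (v i) (w i)) ∈ T) : G.IsBlock T (transLines K' u w L) :=
  Scaffold.isBlock_of_forall fun θ hθ => by
    obtain ⟨i, hi, rfl⟩ := List.mem_map.1 hθ
    rw [List.mem_range] at hi
    exact Or.inr (Logic.infer hGL 6 (by decide) (FregeSystem.sub [K', var (u i), var (v i), var (w i)]) rfl
      (FregeSystem.prems_cons (h₁ i hi) (FregeSystem.prems_cons (h₂ i hi) FregeSystem.prems_nil)))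

/-! ### The derivation -/

section Derivation

variable (o : Occ) (L : ℕ) (K' : PropForm ℕ) (m : ℕ)

/-- The range data of `N₂` and `N₅`. [folklore] -/
def lt2 : LtData := ⟨N₂ o L, L, o.base + off L 2, o.base + off L 3, o.base + off L 10⟩
/-- The range data of `N₅`. [folklore] -/
def lt5 : LtData := ⟨N₅ o L, L, o.base + off L 1, o.base + off L 3, o.base + off L 11⟩

/-- The 38 segments of the derivation of the interchange law. [folklore] -/
def segs : List (List (PropForm ℕ)) :=
  [Adder.reflLines K' ((List.range L).map (a o) ++ (List.range L).map (b o L) ++ (List.range L).map (c o L) ++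
      (List.range L).map (d o L) ++ (List.range L).map ((N₂ o L).R L) ++ (List.range L).map ((N₅ o L).R L) ++
      (List.range L).map (n o L)),                                                    -- 0 reflexivity
   (lt2 o L).lines K', (lt5 o L).lines K',                                             -- 1 2 ranges of R(N₂), R(N₅)
   ModMulU.highLines (CN2 o L) K' L m, ModMulU.highLines (CN5 o L) K' L m,            -- 3 4 high bits
   AssocKit.transferLines (Ca o L) (KD o L 12).A K' L, AssocKit.transferLines (CN2 o L) (KD o L 12).C K' L,   -- 5 6
   AssocKit.transferLines (Cb o L) (KD o L 13).A K' L, AssocKit.transferLines (Cd o L) (KD o L 13).C K' L,    -- 7 8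
   AssocKit.transferLines (Cc o L) (KD o L 14).A K' L, AssocKit.transferLines (Cd o L) (KD o L 14).C K' L,    -- 9 10
   AssocKit.transferLines (Ca o L) (KD o L 15).A K' L, AssocKit.transferLines (CN5 o L) (KD o L 15).C K' L,   -- 11 12
   (KD o L 12).lines K', (KD o L 13).lines K', (KD o L 14).lines K', (KD o L 15).lines K',   -- 13 14 15 16 kits
   (⟨(KD o L 13).M₁, (KD o L 14).M₁, L⟩ : PairData).commLines K',                     -- 17 comm
   (⟨N₁ o L, (KD o L 12).M₁, L⟩ : PairData).leibLines K',                             -- 18 L0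
   (⟨N₂ o L, (KD o L 13).M₃, L⟩ : PairData).leibLines K',                             -- 19 L2a
   (⟨(KD o L 14).M₃, N₅ o L, L⟩ : PairData).leibLines K',                             -- 20 L4a
   (⟨(KD o L 15).M₁, N₄ o L, L⟩ : PairData).leibLines K',                             -- 21 L6a
   (⟨N₃ o L, (KD o L 12).M₂, L⟩ : PairData).leibLines K',                             -- 22 L1
   (⟨(KD o L 12).M₃, (KD o L 13).M₄, L⟩ : PairData).leibLines K',                     -- 23 L2
   (⟨(KD o L 13).M₂, (KD o L 14).M₂, L⟩ : PairData).leibLines K',                     -- 24 L3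
   (⟨(KD o L 14).M₄, (KD o L 15).M₃, L⟩ : PairData).leibLines K',                     -- 25 L4
   symmLines K' ((KD o L 13).M₂.R L) ((KD o L 13).M₄.R L) L,                           -- 26 symK2
   transLines K' ((KD o L 12).M₃.R L) ((KD o L 13).M₂.R L) L,                           -- 27 X1
   transLines K' ((KD o L 12).M₃.R L) ((KD o L 14).M₂.R L) L,                           -- 28 X2
   transLines K' ((KD o L 12).M₃.R L) ((KD o L 14).M₄.R L) L,                           -- 29 X3
   transLines K' ((KD o L 12).M₃.R L) ((KD o L 15).M₃.R L) L,                           -- 30 X4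
   (⟨(KD o L 12).M₄, (KD o L 15).M₄, L⟩ : PairData).leibLines K',                     -- 31 L5
   (⟨(KD o L 15).M₂, N₆ o L, L⟩ : PairData).leibLines K',                             -- 32 L6
   symmLines K' ((KD o L 15).M₂.R L) ((KD o L 15).M₄.R L) L,                           -- 33 symK4
   transLines K' ((N₃ o L).R L) ((KD o L 12).M₄.R L) L,                                 -- 34 F1
   transLines K' ((N₃ o L).R L) ((KD o L 15).M₄.R L) L,                                 -- 35 F2
   transLines K' ((N₃ o L).R L) ((KD o L 15).M₂.R L) L,                                 -- 36 F3
   transLines K' ((N₃ o L).R L) ((N₆ o L).R L) L]                                       -- 37 F4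

/-- All lines of the derivation. [folklore] -/
def lines : List (PropForm ℕ) := (segs o L K' m).flatten

end Derivation

variable {G : FregeSystem}

/-- **The middle-four interchange of modular addition inside Frege**: for an available occurrence
of the kit with `a, b, c, d < n` (facts about the kit's comparators) and the high bits of
`a, b, c, d, n` false from position `m` on (`m + 2 ≤ L`), the lines of `MFI.segs` form a block;
its last segment is the bitwise equality `R(N₃) ≡ R(N₆)`, i.e.
`(a ⊕ b) ⊕ (c ⊕ d) = (a ⊕ c) ⊕ (b ⊕ d)`. [cite: CookReckhow1979, §2; Krajicek1995, §9.2] -/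
theorem isBlock_lines (hG : ∀ r ∈ assocRules, r ∈ G.rules) (hGM : ∀ r ∈ rules, r ∈ G.rules)
    (hGR : ∀ r ∈ ModMulU.rangeRules, r ∈ G.rules) (hGN : ∀ r ∈ Netlist.rules, r ∈ G.rules)
    (hGA : ∀ r ∈ Adder.rules, r ∈ G.rules) (hGL : ∀ r ∈ Logic.rules, r ∈ G.rules) (hGG : ∀ r ∈ glueRules, r ∈ G.rules)
    (h : MAvail o L K' Γ) {m : ℕ} (hm : m + 2 ≤ L)
    (hfa : ctx K' (neg (var ((Ca o L).ge L L))) ∈ Γ) (hfb : ctx K' (neg (var ((Cb o L).ge L L))) ∈ Γ)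
    (hfc : ctx K' (neg (var ((Cc o L).ge L L))) ∈ Γ) (hfd : ctx K' (neg (var ((Cd o L).ge L L))) ∈ Γ)
    (ha : ∀ i, m ≤ i → i < L → ctx K' (neg (var (a o i))) ∈ Γ) (hb : ∀ i, m ≤ i → i < L → ctx K' (neg (var (b o L i))) ∈ Γ)
    (hc : ∀ i, m ≤ i → i < L → ctx K' (neg (var (c o L i))) ∈ Γ) (hd : ∀ i, m ≤ i → i < L → ctx K' (neg (var (d o L i))) ∈ Γ)
    (hn : ∀ i, m ≤ i → i < L → ctx K' (neg (var (n o L i))) ∈ Γ) : G.IsBlock Γ (lines o L K' m) := by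
  -- the kit data
  have hK12 : (KD o L 12).Avail K' Γ := AssocKit.avail_data (h.hK 12 (by norm_num) (by norm_num))
  have hK13 : (KD o L 13).Avail K' Γ := AssocKit.avail_data (h.hK 13 (by norm_num) (by norm_num))
  have hK14 : (KD o L 14).Avail K' Γ := AssocKit.avail_data (h.hK 14 (by norm_num) (by norm_num))
  have hK15 : (KD o L 15).Avail K' Γ := AssocKit.avail_data (h.hK 15 (by norm_num) (by norm_num))
  refine AssocData.isBlock_flatten _ fun k hk => ?_
  simp only [segs, List.length_cons, List.length_nil] at hk
  have mem : ∀ {χ} (j : ℕ) (hj : j < k) (hχ : χ ∈ (segs o L K' m)[j]'(by simp [segs]; omega)),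
      χ ∈ Γ ∪ {χ | ∃ j, ∃ hj : j < k, χ ∈ (segs o L K' m)[j]'(by simp [segs]; omega)} := fun j hj hχ => Or.inr ⟨j, hj, hχ⟩
  have hΓ : Γ ⊆ Γ ∪ {χ | ∃ j, ∃ hj : j < k, χ ∈ (segs o L K' m)[j]'(by simp [segs]; omega)} := fun _ hχ => Or.inl hχ
  -- reflexivity lines of the seven words
  have rf : 0 < k → ∀ (w : ℕ) (x : ℕ → ℕ), (w = 0 ∧ x = a o ∨ w = 1 ∧ x = b o L ∨ w = 2 ∧ x = c o L ∨ w = 3 ∧ x = d o L ∨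
      w = 4 ∧ x = (N₂ o L).R L ∨ w = 5 ∧ x = (N₅ o L).R L ∨ w = 6 ∧ x = n o L) → ∀ i < L,
      ctx K' (eqv (x i) (x i)) ∈ Γ ∪ {χ | ∃ j, ∃ hj : j < k, χ ∈ (segs o L K' m)[j]'(by simp [segs]; omega)} := by
    intro hk0 w x hx i hi
    refine mem 0 hk0 (Adder.mem_reflLines ?_)
    simp only [List.mem_append, List.mem_map, List.mem_range]
    rcases hx with ⟨-, rfl⟩ | ⟨-, rfl⟩ | ⟨-, rfl⟩ | ⟨-, rfl⟩ | ⟨-, rfl⟩ | ⟨-, rfl⟩ | ⟨-, rfl⟩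
    · exact Or.inl (Or.inl (Or.inl (Or.inl (Or.inl (Or.inl ⟨i, hi, rfl⟩)))))
    · exact Or.inl (Or.inl (Or.inl (Or.inl (Or.inl (Or.inr ⟨i, hi, rfl⟩)))))
    · exact Or.inl (Or.inl (Or.inl (Or.inl (Or.inr ⟨i, hi, rfl⟩))))
    · exact Or.inl (Or.inl (Or.inl (Or.inr ⟨i, hi, rfl⟩)))
    · exact Or.inl (Or.inl (Or.inr ⟨i, hi, rfl⟩))
    · exact Or.inl (Or.inr ⟨i, hi, rfl⟩)
    · exact Or.inr ⟨i, hi, rfl⟩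
  interval_cases k
  · -- 0: reflexivity
    exact Adder.isBlock_reflLines hGA _ _ _
  · -- 1: R(N₂) < n
    exact (lt2 o L).isBlock_lines hGM hGA (h.hN₂.mono hΓ) (h.hCc.mono hΓ) (h.hCd.mono hΓ) (h.hCN2.mono hΓ) (hΓ hfc) (hΓ hfd)
  · -- 2: R(N₅) < n
    exact (lt5 o L).isBlock_lines hGM hGA (h.hN₅.mono hΓ) (h.hCb.mono hΓ) (h.hCd.mono hΓ) (h.hCN5.mono hΓ) (hΓ hfb) (hΓ hfd)
  · -- 3: high bits of R(N₂)
    exact ModMulU.isBlock_highLines hGR (h.hCN2.mono hΓ) (fun i h₁ h₂ => hΓ (hn i h₁ h₂)) (mem 1 (by omega) (lt2 o L).mem_lines)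
  · -- 4: high bits of R(N₅)
    exact ModMulU.isBlock_highLines hGR (h.hCN5.mono hΓ) (fun i h₁ h₂ => hΓ (hn i h₁ h₂)) (mem 2 (by omega) (lt5 o L).mem_lines)
  · -- 5: transfer a < n into kit 12
    exact AssocKit.isBlock_transferLines hGN hGA hGL (h.hCa.mono hΓ) (hK12.hA.mono hΓ)
      (fun i hi => (K1_a (o := o) hi).symm) (fun i hi => (K1_n (o := o) hi).symm) (hΓ hfa)
  · -- 6: transfer R(N₂) < n into kit 12
    exact AssocKit.isBlock_transferLines hGN hGA hGL (h.hCN2.mono hΓ) (hK12.hC.mono hΓ)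
      (fun i hi => (K1_c (o := o) hi).symm) (fun i hi => (K1_n (o := o) hi).symm) (mem 1 (by omega) (lt2 o L).mem_lines)
  · -- 7: transfer b < n into kit 13
    exact AssocKit.isBlock_transferLines hGN hGA hGL (h.hCb.mono hΓ) (hK13.hA.mono hΓ)
      (fun i hi => (K2_a (o := o) hi).symm) (fun i hi => (K2_n (o := o) hi).symm) (hΓ hfb)
  · -- 8: transfer d < n into kit 13
    exact AssocKit.isBlock_transferLines hGN hGA hGL (h.hCd.mono hΓ) (hK13.hC.mono hΓ)
      (fun i hi => (K2_c (o := o) hi).symm) (fun i hi => (K2_n (o := o) hi).symm) (hΓ hfd)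
  · -- 9: transfer c < n into kit 14
    exact AssocKit.isBlock_transferLines hGN hGA hGL (h.hCc.mono hΓ) (hK14.hA.mono hΓ)
      (fun i hi => (K3_a (o := o) hi).symm) (fun i hi => (K3_n (o := o) hi).symm) (hΓ hfc)
  · -- 10: transfer d < n into kit 14
    exact AssocKit.isBlock_transferLines hGN hGA hGL (h.hCd.mono hΓ) (hK14.hC.mono hΓ)
      (fun i hi => (K3_c (o := o) hi).symm) (fun i hi => (K3_n (o := o) hi).symm) (hΓ hfd)
  · -- 11: transfer a < n into kit 15
    exact AssocKit.isBlock_transferLines hGN hGA hGL (h.hCa.mono hΓ) (hK15.hA.mono hΓ)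
      (fun i hi => (K4_a (o := o) hi).symm) (fun i hi => (K4_n (o := o) hi).symm) (hΓ hfa)
  · -- 12: transfer R(N₅) < n into kit 15
    exact AssocKit.isBlock_transferLines hGN hGA hGL (h.hCN5.mono hΓ) (hK15.hC.mono hΓ)
      (fun i hi => (K4_c (o := o) hi).symm) (fun i hi => (K4_n (o := o) hi).symm) (mem 2 (by omega) (lt5 o L).mem_lines)
  · -- 13: kit 12: (a⊕b)⊕R(N₂) ≡ a⊕(b⊕R(N₂))
    refine (KD o L 12).isBlock_lines hG hGN hGA hGL hGG (hK12.mono hΓ) hm (fun i h₁ h₂ => ?_) (fun i h₁ h₂ => ?_)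
      (fun i h₁ h₂ => ?_) (mem 5 (by omega) (AssocKit.mem_transferLines _ _ _ _))
      (mem 6 (by omega) (AssocKit.mem_transferLines _ _ _ _))
    · show ctx K' (neg (var ((K o L 12).inp i))) ∈ _; rw [K1_a (L := L) (o := o) (show i < L from h₂)]; exact hΓ (ha i h₁ (show i < L from h₂))
    · show ctx K' (neg (var ((K o L 12).inp (L + i)))) ∈ _; rw [K1_b (L := L) (o := o) (show i < L from h₂)]; exact hΓ (hb i h₁ (show i < L from h₂))
    · show ctx K' (neg (var ((K o L 12).inp (2 * L + i)))) ∈ _; rw [K1_c (L := L) (o := o) (show i < L from h₂)]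
      exact mem 3 (by omega) (ModMulU.mem_highLines h₁ (show i < L from h₂))
  · -- 14: kit 13: (b⊕c)⊕d ≡ b⊕(c⊕d)
    refine (KD o L 13).isBlock_lines hG hGN hGA hGL hGG (hK13.mono hΓ) hm (fun i h₁ h₂ => ?_) (fun i h₁ h₂ => ?_)
      (fun i h₁ h₂ => ?_) (mem 7 (by omega) (AssocKit.mem_transferLines _ _ _ _))
      (mem 8 (by omega) (AssocKit.mem_transferLines _ _ _ _))
    · show ctx K' (neg (var ((K o L 13).inp i))) ∈ _; rw [K2_a (L := L) (o := o) (show i < L from h₂)]; exact hΓ (hb i h₁ (show i < L from h₂))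
    · show ctx K' (neg (var ((K o L 13).inp (L + i)))) ∈ _; rw [K2_b (L := L) (o := o) (show i < L from h₂)]; exact hΓ (hc i h₁ (show i < L from h₂))
    · show ctx K' (neg (var ((K o L 13).inp (2 * L + i)))) ∈ _; rw [K2_c (L := L) (o := o) (show i < L from h₂)]; exact hΓ (hd i h₁ (show i < L from h₂))
  · -- 15: kit 14: (c⊕b)⊕d ≡ c⊕(b⊕d)
    refine (KD o L 14).isBlock_lines hG hGN hGA hGL hGG (hK14.mono hΓ) hm (fun i h₁ h₂ => ?_) (fun i h₁ h₂ => ?_)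
      (fun i h₁ h₂ => ?_) (mem 9 (by omega) (AssocKit.mem_transferLines _ _ _ _))
      (mem 10 (by omega) (AssocKit.mem_transferLines _ _ _ _))
    · show ctx K' (neg (var ((K o L 14).inp i))) ∈ _; rw [K3_a (L := L) (o := o) (show i < L from h₂)]; exact hΓ (hc i h₁ (show i < L from h₂))
    · show ctx K' (neg (var ((K o L 14).inp (L + i)))) ∈ _; rw [K3_b (L := L) (o := o) (show i < L from h₂)]; exact hΓ (hb i h₁ (show i < L from h₂))
    · show ctx K' (neg (var ((K o L 14).inp (2 * L + i)))) ∈ _; rw [K3_c (L := L) (o := o) (show i < L from h₂)]; exact hΓ (hd i h₁ (show i < L from h₂))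
  · -- 16: kit 15: (a⊕c)⊕R(N₅) ≡ a⊕(c⊕R(N₅))
    refine (KD o L 15).isBlock_lines hG hGN hGA hGL hGG (hK15.mono hΓ) hm (fun i h₁ h₂ => ?_) (fun i h₁ h₂ => ?_)
      (fun i h₁ h₂ => ?_) (mem 11 (by omega) (AssocKit.mem_transferLines _ _ _ _))
      (mem 12 (by omega) (AssocKit.mem_transferLines _ _ _ _))
    · show ctx K' (neg (var ((K o L 15).inp i))) ∈ _; rw [K4_a (L := L) (o := o) (show i < L from h₂)]; exact hΓ (ha i h₁ (show i < L from h₂))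
    · show ctx K' (neg (var ((K o L 15).inp (L + i)))) ∈ _; rw [K4_b (L := L) (o := o) (show i < L from h₂)]; exact hΓ (hc i h₁ (show i < L from h₂))
    · show ctx K' (neg (var ((K o L 15).inp (2 * L + i)))) ∈ _; rw [K4_c (L := L) (o := o) (show i < L from h₂)]
      exact mem 4 (by omega) (ModMulU.mem_highLines h₁ (show i < L from h₂))
  · -- 17: commutativity b⊕c ≡ c⊕b (kit 13's M₁ and kit 14's M₁)
    refine (⟨(KD o L 13).M₁, (KD o L 14).M₁, L⟩ : PairData).isBlock_commLines hGN hGA hGL (hK13.hM₁.mono hΓ)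
      (hK14.hM₁.mono hΓ) (fun i hi => ?_) (fun i hi => ?_) (fun i hi => ?_)
    · show ctx K' (eqv ((K o L 13).inp i) ((K o L 14).inp (L + i))) ∈ _
      rw [K2_a hi, K3_b hi]; exact rf (by omega) 1 (b o L) (by simp) i hi
    · show ctx K' (eqv ((K o L 13).inp (L + i)) ((K o L 14).inp i)) ∈ _
      rw [K2_b hi, K3_a hi]; exact rf (by omega) 2 (c o L) (by simp) i hi
    · show ctx K' (eqv ((K o L 13).inp (3 * L + i)) ((K o L 14).inp (3 * L + i))) ∈ _
      rw [K2_n hi, K3_n hi]; exact rf (by omega) 6 (n o L) (by simp) i hi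
  · -- 18: N₁ ≡ kit 12's M₁
    refine (⟨N₁ o L, (KD o L 12).M₁, L⟩ : PairData).isBlock_leibLines hGN hGL (h.hN₁.mono hΓ) (hK12.hM₁.mono hΓ)
      (fun i hi => ?_) (fun i hi => ?_) (fun i hi => ?_)
    · show ctx K' (eqv (o.inp i) ((K o L 12).inp i)) ∈ _; rw [K1_a hi]; exact rf (by omega) 0 (a o) (by simp) i hi
    · show ctx K' (eqv (o.inp (L + i)) ((K o L 12).inp (L + i))) ∈ _; rw [K1_b hi]; exact rf (by omega) 1 (b o L) (by simp) i hi
    · show ctx K' (eqv (o.inp (4 * L + i)) ((K o L 12).inp (3 * L + i))) ∈ _; rw [K1_n hi]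
      exact rf (by omega) 6 (n o L) (by simp) i hi
  · -- 19: N₂ ≡ kit 13's M₃ = c ⊕ d
    refine (⟨N₂ o L, (KD o L 13).M₃, L⟩ : PairData).isBlock_leibLines hGN hGL (h.hN₂.mono hΓ) (hK13.hM₃.mono hΓ)
      (fun i hi => ?_) (fun i hi => ?_) (fun i hi => ?_)
    · show ctx K' (eqv (o.inp (2 * L + i)) ((K o L 13).inp (L + i))) ∈ _; rw [K2_b hi]
      exact rf (by omega) 2 (c o L) (by simp) i hi
    · show ctx K' (eqv (o.inp (3 * L + i)) ((K o L 13).inp (2 * L + i))) ∈ _; rw [K2_c hi]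
      exact rf (by omega) 3 (d o L) (by simp) i hi
    · show ctx K' (eqv (o.inp (4 * L + i)) ((K o L 13).inp (3 * L + i))) ∈ _; rw [K2_n hi]
      exact rf (by omega) 6 (n o L) (by simp) i hi
  · -- 20: kit 14's M₃ = b ⊕ d ≡ N₅
    refine (⟨(KD o L 14).M₃, N₅ o L, L⟩ : PairData).isBlock_leibLines hGN hGL (hK14.hM₃.mono hΓ) (h.hN₅.mono hΓ)
      (fun i hi => ?_) (fun i hi => ?_) (fun i hi => ?_)
    · show ctx K' (eqv ((K o L 14).inp (L + i)) (o.inp (L + i))) ∈ _; rw [K3_b hi]; exact rf (by omega) 1 (b o L) (by simp) i hi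
    · show ctx K' (eqv ((K o L 14).inp (2 * L + i)) (o.inp (3 * L + i))) ∈ _; rw [K3_c hi]
      exact rf (by omega) 3 (d o L) (by simp) i hi
    · show ctx K' (eqv ((K o L 14).inp (3 * L + i)) (o.inp (4 * L + i))) ∈ _; rw [K3_n hi]
      exact rf (by omega) 6 (n o L) (by simp) i hi
  · -- 21: kit 15's M₁ = a ⊕ c ≡ N₄
    refine (⟨(KD o L 15).M₁, N₄ o L, L⟩ : PairData).isBlock_leibLines hGN hGL (hK15.hM₁.mono hΓ) (h.hN₄.mono hΓ)
      (fun i hi => ?_) (fun i hi => ?_) (fun i hi => ?_)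
    · show ctx K' (eqv ((K o L 15).inp i) (o.inp i)) ∈ _; rw [K4_a hi]; exact rf (by omega) 0 (a o) (by simp) i hi
    · show ctx K' (eqv ((K o L 15).inp (L + i)) (o.inp (2 * L + i))) ∈ _; rw [K4_b hi]
      exact rf (by omega) 2 (c o L) (by simp) i hi
    · show ctx K' (eqv ((K o L 15).inp (3 * L + i)) (o.inp (4 * L + i))) ∈ _; rw [K4_n hi]
      exact rf (by omega) 6 (n o L) (by simp) i hi
  · -- 22: N₃ ≡ kit 12's M₂
    refine (⟨N₃ o L, (KD o L 12).M₂, L⟩ : PairData).isBlock_leibLines hGN hGL (h.hN₃.mono hΓ) (hK12.hM₂.mono hΓ)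
      (fun i hi => ?_) (fun i hi => ?_) (fun i hi => ?_)
    · exact mem 18 (by omega) ((⟨N₁ o L, (KD o L 12).M₁, L⟩ : PairData).mem_leibLines hi)
    · show ctx K' (eqv ((N₂ o L).R L i) ((K o L 12).inp (2 * L + i))) ∈ _; rw [K1_c hi]
      exact rf (by omega) 4 ((N₂ o L).R L) (by simp) i hi
    · show ctx K' (eqv (o.inp (4 * L + i)) ((K o L 12).inp (3 * L + i))) ∈ _; rw [K1_n hi]
      exact rf (by omega) 6 (n o L) (by simp) i hi
  · -- 23: kit 12's M₃ = b ⊕ R(N₂) ≡ kit 13's M₄ = b ⊕ (c ⊕ d)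
    refine (⟨(KD o L 12).M₃, (KD o L 13).M₄, L⟩ : PairData).isBlock_leibLines hGN hGL (hK12.hM₃.mono hΓ) (hK13.hM₄.mono hΓ)
      (fun i hi => ?_) (fun i hi => ?_) (fun i hi => ?_)
    · show ctx K' (eqv ((K o L 12).inp (L + i)) ((K o L 13).inp i)) ∈ _; rw [K1_b hi, K2_a hi]
      exact rf (by omega) 1 (b o L) (by simp) i hi
    · show ctx K' (eqv ((K o L 12).inp (2 * L + i)) ((KD o L 13).M₃.R L i)) ∈ _; rw [K1_c hi]
      exact mem 19 (by omega) ((⟨N₂ o L, (KD o L 13).M₃, L⟩ : PairData).mem_leibLines hi)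
    · show ctx K' (eqv ((K o L 12).inp (3 * L + i)) ((K o L 13).inp (3 * L + i))) ∈ _; rw [K1_n hi, K2_n hi]
      exact rf (by omega) 6 (n o L) (by simp) i hi
  · -- 24: kit 13's M₂ = (b⊕c)⊕d ≡ kit 14's M₂ = (c⊕b)⊕d
    refine (⟨(KD o L 13).M₂, (KD o L 14).M₂, L⟩ : PairData).isBlock_leibLines hGN hGL (hK13.hM₂.mono hΓ) (hK14.hM₂.mono hΓ)
      (fun i hi => ?_) (fun i hi => ?_) (fun i hi => ?_)
    · exact mem 17 (by omega) ((⟨(KD o L 13).M₁, (KD o L 14).M₁, L⟩ : PairData).mem_commLines hi)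
    · show ctx K' (eqv ((K o L 13).inp (2 * L + i)) ((K o L 14).inp (2 * L + i))) ∈ _; rw [K2_c hi, K3_c hi]
      exact rf (by omega) 3 (d o L) (by simp) i hi
    · show ctx K' (eqv ((K o L 13).inp (3 * L + i)) ((K o L 14).inp (3 * L + i))) ∈ _; rw [K2_n hi, K3_n hi]
      exact rf (by omega) 6 (n o L) (by simp) i hi
  · -- 25: kit 14's M₄ = c ⊕ (b ⊕ d) ≡ kit 15's M₃ = c ⊕ R(N₅)
    refine (⟨(KD o L 14).M₄, (KD o L 15).M₃, L⟩ : PairData).isBlock_leibLines hGN hGL (hK14.hM₄.mono hΓ) (hK15.hM₃.mono hΓ)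
      (fun i hi => ?_) (fun i hi => ?_) (fun i hi => ?_)
    · show ctx K' (eqv ((K o L 14).inp i) ((K o L 15).inp (L + i))) ∈ _; rw [K3_a hi, K4_b hi]
      exact rf (by omega) 2 (c o L) (by simp) i hi
    · show ctx K' (eqv ((KD o L 14).M₃.R L i) ((K o L 15).inp (2 * L + i))) ∈ _; rw [K4_c hi]
      exact mem 20 (by omega) ((⟨(KD o L 14).M₃, N₅ o L, L⟩ : PairData).mem_leibLines hi)
    · show ctx K' (eqv ((K o L 14).inp (3 * L + i)) ((K o L 15).inp (3 * L + i))) ∈ _; rw [K3_n hi, K4_n hi]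
      exact rf (by omega) 6 (n o L) (by simp) i hi
  · -- 26: symmetry of kit 13's conclusion
    exact isBlock_symmLines hGL K' fun i hi => mem 14 (by omega) ((KD o L 13).mem_lines hi)
  · -- 27: M₃(12) ≡ M₄(13) ≡ M₂(13)
    exact isBlock_transLines hGL K'
      (fun i hi => mem 23 (by omega) ((⟨(KD o L 12).M₃, (KD o L 13).M₄, L⟩ : PairData).mem_leibLines hi))
      (fun i hi => mem 26 (by omega) (Netlist.mem_map_range hi))
  · -- 28: … ≡ M₂(14)
    exact isBlock_transLines hGL K' (fun i hi => mem 27 (by omega) (Netlist.mem_map_range hi))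
      (fun i hi => mem 24 (by omega) ((⟨(KD o L 13).M₂, (KD o L 14).M₂, L⟩ : PairData).mem_leibLines hi))
  · -- 29: … ≡ M₄(14)
    exact isBlock_transLines hGL K' (fun i hi => mem 28 (by omega) (Netlist.mem_map_range hi))
      (fun i hi => mem 15 (by omega) ((KD o L 14).mem_lines hi))
  · -- 30: … ≡ M₃(15)
    exact isBlock_transLines hGL K' (fun i hi => mem 29 (by omega) (Netlist.mem_map_range hi))
      (fun i hi => mem 25 (by omega) ((⟨(KD o L 14).M₄, (KD o L 15).M₃, L⟩ : PairData).mem_leibLines hi))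
  · -- 31: kit 12's M₄ = a ⊕ M₃(12) ≡ kit 15's M₄ = a ⊕ M₃(15)
    refine (⟨(KD o L 12).M₄, (KD o L 15).M₄, L⟩ : PairData).isBlock_leibLines hGN hGL (hK12.hM₄.mono hΓ) (hK15.hM₄.mono hΓ)
      (fun i hi => ?_) (fun i hi => ?_) (fun i hi => ?_)
    · show ctx K' (eqv ((K o L 12).inp i) ((K o L 15).inp i)) ∈ _; rw [K1_a hi, K4_a hi]
      exact rf (by omega) 0 (a o) (by simp) i hi
    · exact mem 30 (by omega) (Netlist.mem_map_range hi)
    · show ctx K' (eqv ((K o L 12).inp (3 * L + i)) ((K o L 15).inp (3 * L + i))) ∈ _; rw [K1_n hi, K4_n hi]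
      exact rf (by omega) 6 (n o L) (by simp) i hi
  · -- 32: kit 15's M₂ = (a⊕c) ⊕ R(N₅) ≡ N₆
    refine (⟨(KD o L 15).M₂, N₆ o L, L⟩ : PairData).isBlock_leibLines hGN hGL (hK15.hM₂.mono hΓ) (h.hN₆.mono hΓ)
      (fun i hi => ?_) (fun i hi => ?_) (fun i hi => ?_)
    · exact mem 21 (by omega) ((⟨(KD o L 15).M₁, N₄ o L, L⟩ : PairData).mem_leibLines hi)
    · show ctx K' (eqv ((K o L 15).inp (2 * L + i)) ((N₅ o L).R L i)) ∈ _; rw [K4_c hi]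
      exact rf (by omega) 5 ((N₅ o L).R L) (by simp) i hi
    · show ctx K' (eqv ((K o L 15).inp (3 * L + i)) (o.inp (4 * L + i))) ∈ _; rw [K4_n hi]
      exact rf (by omega) 6 (n o L) (by simp) i hi
  · -- 33: symmetry of kit 15's conclusion
    exact isBlock_symmLines hGL K' fun i hi => mem 16 (by omega) ((KD o L 15).mem_lines hi)
  · -- 34: R(N₃) ≡ M₂(12) ≡ M₄(12)
    exact isBlock_transLines hGL K'
      (fun i hi => mem 22 (by omega) ((⟨N₃ o L, (KD o L 12).M₂, L⟩ : PairData).mem_leibLines hi))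
      (fun i hi => mem 13 (by omega) ((KD o L 12).mem_lines hi))
  · -- 35: … ≡ M₄(15)
    exact isBlock_transLines hGL K' (fun i hi => mem 34 (by omega) (Netlist.mem_map_range hi))
      (fun i hi => mem 31 (by omega) ((⟨(KD o L 12).M₄, (KD o L 15).M₄, L⟩ : PairData).mem_leibLines hi))
  · -- 36: … ≡ M₂(15)
    exact isBlock_transLines hGL K' (fun i hi => mem 35 (by omega) (Netlist.mem_map_range hi))
      (fun i hi => mem 33 (by omega) (Netlist.mem_map_range hi))
  · -- 37: … ≡ R(N₆)
    exact isBlock_transLines hGL K' (fun i hi => mem 36 (by omega) (Netlist.mem_map_range hi))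
      (fun i hi => mem 32 (by omega) ((⟨(KD o L 15).M₂, N₆ o L, L⟩ : PairData).mem_leibLines hi))

/-- **The conclusion of the interchange law**: `R(N₃)ᵢ ↔ R(N₆)ᵢ` for `i < L`. [folklore] -/
theorem mem_lines {o : Occ} {L : ℕ} {K' : PropForm ℕ} {m i : ℕ} (hi : i < L) :
    ctx K' (eqv ((N₃ o L).R L i) ((N₆ o L).R L i)) ∈ lines o L K' m := by
  simp only [lines, segs, List.flatten_cons, List.flatten_nil, List.mem_append, List.append_nil]
  iterate 37 refine Or.inr ?_
  exact Netlist.mem_map_range hi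

/-! ### The size of the derivation -/

/-- Lines of congruence/commutativity blocks have size `≤ |K| + 10`. [folklore] -/
theorem bounded_pair {B : ℕ} (d : PairData) (K' : PropForm ℕ) (hK : K'.size + 10 ≤ B) :
    Bounded B (d.leibLines K') ∧ Bounded B (d.commLines K') := by
  have ht : Bounded B (d.tail K') := (bounded_subLeib _ _ _ _ hK).append (bounded_ctx_eqv K' hK _ _ _)
  exact ⟨(bounded_ctx_eqv K' hK _ _ _).append ht, (bounded_ctx_eqv K' hK _ _ _).append ht⟩

/-- Lines of a range block have size `≤ |K| + 153`. [folklore] -/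
theorem bounded_lt {B : ℕ} (d : LtData) (K' : PropForm ℕ) (hK : K'.size + 153 ≤ B) : Bounded B (d.lines K') := by
  have hLT : LT.inv.size = 152 := by decide +kernel
  refine (bounded_sysLines _ _ _ _ (by omega)).append ((bounded_ctx_eqv K' (by omega) [d.M.ge d.L] id id).append
    (Bounded.singleton ?_))
  rw [size_ctx, size_inst]; simp [size]; omega

/-- Lines of a transfer block have size `≤ |K| + 10`. [folklore] -/
theorem bounded_transfer {B : ℕ} (A' A : Sub.View) (K' : PropForm ℕ) (L : ℕ) (hK : K'.size + 10 ≤ B) :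
    Bounded B (AssocKit.transferLines A' A K' L) :=
  (bounded_refl _ _ hK).append ((bounded_subLeib _ _ _ _ hK).append (Bounded.singleton (by rw [size_ctx]; simp [size]; omega)))

/-- Lines of a high-bit block have size `≤ |K| + 3`. [folklore] -/
theorem bounded_high {B : ℕ} (C : Sub.View) (K' : PropForm ℕ) (L m : ℕ) (hK : K'.size + 3 ≤ B) :
    Bounded B (ModMulU.highLines C K' L m) :=
  (Bounded.map fun j _ => by rw [size_ctx]; simp [size]; omega).append
    (Bounded.map fun j _ => by rw [size_ctx]; simp [size]; omega)

/-- **Every line of the interchange law has size `≤ |K| + 153`.** [folklore] -/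
theorem bounded_lines (o : Occ) (L : ℕ) (K' : PropForm ℕ) (m : ℕ) : Bounded (K'.size + 153) (lines o L K' m) := by
  refine Bounded.flatten fun D hD => ?_
  simp only [segs, List.mem_cons, List.not_mem_nil, or_false] at hD
  rcases hD with rfl | rfl | rfl | rfl | rfl | rfl | rfl | rfl | rfl | rfl | rfl | rfl | rfl | rfl | rfl | rfl | rfl | rfl | rfl |
    rfl | rfl | rfl | rfl | rfl | rfl | rfl | rfl | rfl | rfl | rfl | rfl | rfl | rfl | rfl | rfl | rfl | rfl | rfl
  · exact bounded_refl _ _ (by omega)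
  · exact bounded_lt _ _ le_rfl
  · exact bounded_lt _ _ le_rfl
  · exact bounded_high _ _ _ _ (by omega)
  · exact bounded_high _ _ _ _ (by omega)
  iterate 8 · exact bounded_transfer _ _ _ _ (by omega)
  iterate 4 · exact (AssocData.bounded_lines _ _).mono (by omega)
  · exact (bounded_pair _ _ (by omega)).2
  iterate 8 · exact (bounded_pair _ _ (by omega)).1
  iterate 5 · exact bounded_ctx_eqv K' (by omega) _ _ _
  · exact (bounded_pair _ _ (by omega)).1
  · exact (bounded_pair _ _ (by omega)).1
  iterate 5 · exact bounded_ctx_eqv K' (by omega) _ _ _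

/-- **The interchange law has at most `460L + 310` lines.** [folklore] -/
theorem length_lines_le (o : Occ) (L : ℕ) (K' : PropForm ℕ) (m : ℕ) : (lines o L K' m).length ≤ 460 * L + 310 := by
  have hk : ∀ k, 12 ≤ k → k < 16 → ((KD o L k).lines K').length = 82 * L + 65 := fun k _ _ => AssocData.length_lines _ _
  simp only [lines, segs, List.flatten_cons, List.flatten_nil, List.length_append, List.length_nil, hk 12 (by norm_num)
    (by norm_num), hk 13 (by norm_num) (by norm_num), hk 14 (by norm_num) (by norm_num), hk 15 (by norm_num) (by norm_num),
    Adder.reflLines, List.length_map, List.length_range, LtData.lines, System.lines, PairData.leibLines, PairData.commLines,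
    PairData.tail, Adder.leibLines, Adder.commLines, Sub.leibLines, AssocKit.transferLines, ModMulU.highLines,
    ModMulU.highGeLines, ModMulU.highXLines, symmLines, transLines, List.length_cons, lt2, lt5]
  omega

/-- **Size of the interchange law**: `≤ (460L + 310)(|K| + 153)` symbols. [folklore] -/
theorem proofSize_lines (o : Occ) (L : ℕ) (K' : PropForm ℕ) (m : ℕ) :
    proofSize (lines o L K' m) ≤ (460 * L + 310) * (K'.size + 153) :=
  (bounded_lines o L K' m).proofSize_le.trans (Nat.mul_le_mul_right _ (length_lines_le o L K' m))

/-- **The interchange law in compositional form**: from an available occurrence of the kit and the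
facts, the bitwise equality `R(N₃) ≡ R(N₆)` is derived in size `O(L · (|K| + 1))`.
[cite: CookReckhow1979, §2; Krajicek1995, §9.2] -/
theorem yields (hG : ∀ r ∈ assocRules, r ∈ G.rules) (hGM : ∀ r ∈ rules, r ∈ G.rules)
    (hGR : ∀ r ∈ ModMulU.rangeRules, r ∈ G.rules) (hGN : ∀ r ∈ Netlist.rules, r ∈ G.rules)
    (hGA : ∀ r ∈ Adder.rules, r ∈ G.rules) (hGL : ∀ r ∈ Logic.rules, r ∈ G.rules) (hGG : ∀ r ∈ glueRules, r ∈ G.rules)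
    (h : MAvail o L K' Γ) {m : ℕ} (hm : m + 2 ≤ L)
    (hfa : ctx K' (neg (var ((Ca o L).ge L L))) ∈ Γ) (hfb : ctx K' (neg (var ((Cb o L).ge L L))) ∈ Γ)
    (hfc : ctx K' (neg (var ((Cc o L).ge L L))) ∈ Γ) (hfd : ctx K' (neg (var ((Cd o L).ge L L))) ∈ Γ)
    (ha : ∀ i, m ≤ i → i < L → ctx K' (neg (var (a o i))) ∈ Γ) (hb : ∀ i, m ≤ i → i < L → ctx K' (neg (var (b o L i))) ∈ Γ)
    (hc : ∀ i, m ≤ i → i < L → ctx K' (neg (var (c o L i))) ∈ Γ) (hd : ∀ i, m ≤ i → i < L → ctx K' (neg (var (d o L i))) ∈ Γ)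
    (hn : ∀ i, m ≤ i → i < L → ctx K' (neg (var (n o L i))) ∈ Γ) :
    G.Yields Γ (ctxSet K' (eqW ((N₃ o L).R L) ((N₆ o L).R L) L)) ((460 * L + 310) * (K'.size + 153)) := by
  refine Yields.of_isBlock (isBlock_lines hG hGM hGR hGN hGA hGL hGG h hm hfa hfb hfc hfd ha hb hc hd hn) ?_
    (proofSize_lines o L K' m)
  rintro θ ⟨Lb, hLb, rfl⟩
  obtain ⟨i, hi, rfl⟩ := List.mem_map.1 hLb
  exact mem_lines (List.mem_range.1 hi)

end MFI

end ModAddU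

end Literature.Computability.MetaComplexity
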